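import Literature.Computability.AlgebraicComplexity.LandsbergRessayreProofs
import Literature.Computability.AlgebraicComplexity.GrenetEquivariant
import Summits.ValiantsHypothesis.ValiantsHypothesis.Theorems.DetqpThesis.Negative.NotQPBoundedOfExp

/-!
# `Lines/torus_rung_special.lean` — the PROVED special case (floor witness) of the rung `TorusRung`

Forward generator G4 `ladder-down`, unit `fwd-ladder-ValiantsHypothesis-55` (companion of
`Lines/torus_rung.lean`, crux stmt-ValiantsHypothesis-0315 `DetQP.DetqpThesis`).

The symmetry ladder `SymRung Γ` (see `Lines/torus_rung.lean`) is antitone in the group `Γ`.  Its FLOOR —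
the highest rung proved in print AND in the tree — is Landsberg–Ressayre 2017, Thm 2.8
(arXiv:1508.05788, p. 6): every affine determinantal representation of `per_m` (`m ≥ 3`) over `ℂ` that
is equivariant (exact lifts) for the left monomial group `N(T^{GL(E)})` (`leftMonomialSubst ℂ m`:
`x ↦ g x`, `g` a product of permutation and invertible diagonal matrices) has size `≥ 2^m - 1`;
kernel-checked as `Literature.Computability.AlgebraicComplexity.lr_left_equivariant_lower_holds`
(LandsbergRessayreProofs.lean).  The rung `TorusRung` keeps only the diagonal matrices (`T^{GL(E)}`).

Below: (1) the floor by name; (2) the floor in the ladder's quasi-polynomial template form (this is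
literally `SymRung (leftMonomialSubst ℂ)` of the line file, unfolded); (3) the matching UPPER bound one
rung down — Grenet's `2^m - 1` representation is equivariant for the two-sided torus (hence for the left
torus), `Grenet.hasEquivariantDetRepr_perPoly_twoSidedTorus` (GrenetEquivariant.lean) — so the rung's
exponential form `TorusRungExp` would be tight.  No `sorry`.
-/

set_option linter.dupNamespace false

open Literature.Computability.AlgebraicComplexity
open Summit.ValiantsHypothesis.Theorems.DetqpThesis.Negative (exists_ge_qpExp_le)

namespace Summit.ValiantsHypothesis.ValiantsHypothesis.Cruxes.DetqpThesis.TorusRung.Special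

/-- (1) **The floor, exponential form** (Landsberg–Ressayre 2017 Thm 2.8; kernel-checked). -/
example : ∀ m : ℕ, 3 ≤ m → ∀ (n : ℕ) (A : Matrix (Fin n) (Fin n) (MvPolynomial (Fin m × Fin m) ℂ)),
    IsEquivariantDetRepr (leftMonomialSubst ℂ m) (perPoly (Fin m) ℂ) A → 2 ^ m - 1 ≤ n :=
  lr_left_equivariant_lower_holds

/-- Arithmetic: the quasi-polynomial template is eventually below `2^m - 1`. [folklore] -/
theorem qpExp_lt_two_pow_sub_one (c : ℕ) : ∃ m, 3 ≤ m ∧ 2 ^ ((Nat.log 2 m + c) ^ c) < 2 ^ m - 1 := by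
  obtain ⟨m, hm3, -, hexp⟩ := exists_ge_qpExp_le c 3
  refine ⟨m, hm3, ?_⟩
  have h1 : 2 ^ ((Nat.log 2 m + c) ^ c) ≤ 2 ^ (m - 1) := Nat.pow_le_pow_right (by norm_num) hexp
  have h2 : 2 ^ m = 2 * 2 ^ (m - 1) := by rw [← pow_succ']; congr 1; omega
  have h3 : 2 ≤ 2 ^ (m - 1) :=
    calc (2 : ℕ) = 2 ^ 1 := rfl
      _ ≤ 2 ^ (m - 1) := Nat.pow_le_pow_right (by norm_num) (by omega)
  omega

/-- (2) **The floor in the ladder's template form** = `SymRung (leftMonomialSubst ℂ)` unfolded: for every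
template constant `c` some `m ≥ 3` has all `N(T^{GL(E)})`-equivariant representations of `per_m` of size
`> 2 ^ ((log₂ m + c) ^ c)`.  (The rung `TorusRung` is the same sentence with `leftTorusSubst m`, the
diagonal substitutions only, in place of `leftMonomialSubst ℂ m`.) -/
theorem floor_template : ∀ c : ℕ, ∃ m : ℕ, 3 ≤ m ∧
    ∀ (n : ℕ) (A : Matrix (Fin n) (Fin n) (MvPolynomial (Fin m × Fin m) ℂ)),
      IsEquivariantDetRepr (leftMonomialSubst ℂ m) (perPoly (Fin m) ℂ) A → 2 ^ ((Nat.log 2 m + c) ^ c) < n := by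
  intro c
  obtain ⟨m, hm3, hlt⟩ := qpExp_lt_two_pow_sub_one c
  exact ⟨m, hm3, fun n A hA => lt_of_lt_of_le hlt (lr_left_equivariant_lower_holds m hm3 n A hA)⟩

/-- (3) **Tightness one rung down**: `per_m` has a two-sided-torus-equivariant affine determinantal
representation of size `2^m - 1` (Grenet 2011 / Landsberg–Ressayre 2017 §2.2; kernel-checked). -/
example {m : ℕ} (hm : m ≠ 0) :
    HasEquivariantDetRepr
      (Subgroup.closure {γ : GL (Fin m × Fin m) ℂ | ∃ d e : Fin m → ℂ,
        (γ : Matrix (Fin m × Fin m) (Fin m × Fin m) ℂ) = Matrix.diagonal (fun p => d p.1 * e p.2)})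
      (perPoly (Fin m) ℂ) (2 ^ m - 1) :=
  Grenet.hasEquivariantDetRepr_perPoly_twoSidedTorus ℂ hm

end Summit.ValiantsHypothesis.ValiantsHypothesis.Cruxes.DetqpThesis.TorusRung.Special
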